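import Mathlib

/-!
# Crux triage (stmt-Parity-11292, round 1, triager 1): the first lemma `SignFreeSlack n ν y` of card
`sign-free-sieve-lab` is TRIVIALLY INHABITED as typed — by a junk witness, for every `n ≥ 2`, `ν < 1`, `y > 1`.

Mathlib's `Equiv.Perm.cycleType` lists only the NON-TRIVIAL cycle lengths, so `patternCount S σ` never sees fixed
points: the two point masses `δ_1` (identity: cycle type `0`, `n` cycles) and `δ_{finRotate n}` (one `n`-cycle:
cycle type `{n}`, `1` cycle) have identical pattern counts for every pattern of total size `< n` (all zero, except
the empty pattern), yet `E[y^{#cycles}]` is `yⁿ` versus `y`. In the intended dictionary fixed points are the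
SMALLEST primes — the most visible Type-I data — so the typed constraint set is not the card's "Type-I data of
relative level ν". The witness also bites at `y = 2`, `ν = 1/2`, where the INTENDED statement is false
(Dirichlet–Hooley hyperbola: `2^{#cycles}` is an exact linear combination of pattern counts of size `≤ n/2`;
the triage LP toy `compute/lp_width.py` returns width `0` there). Repair: count patterns in the full cycle type
including `1`-cycles (e.g. `σ.cycleType + Multiset.replicate (n - σ.cycleType.sum) 1`) and restrict the claim to
non-integer `y` (or `y ∈ (1, 2)`).
-/

open Finset

namespace Summit.Parity.BatemanHorn.Cruxes.SystemLSDRealSegment.Triage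

/-! ## Verbatim copies of the typed objects (tree file
`Summits/Parity/BatemanHorn/Cruxes/SystemLSDRealSegment/SketchIdeator1.lean`, namespace `…Sketch`;
that crux workfile is not a built module on the farm, so it cannot be imported here). -/

/-- COPY of `Sketch.patternCount`. -/
def patternCount {n : ℕ} (S : Multiset ℕ) (σ : Equiv.Perm (Fin n)) : ℕ :=
  ∏ j ∈ S.toFinset, (σ.cycleType.count j).choose (S.count j)

/-- COPY of `Sketch.SignFreeSlack` (card sign-free-sieve-lab, First lemma). -/
def SignFreeSlack (n : ℕ) (ν y : ℝ) : Prop :=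
  ∃ w₁ w₂ : Equiv.Perm (Fin n) → ℝ,
    (∀ σ, 0 ≤ w₁ σ) ∧ (∀ σ, 0 ≤ w₂ σ) ∧ ∑ σ, w₁ σ = 1 ∧ ∑ σ, w₂ σ = 1 ∧
    (∀ S : Multiset ℕ, ((S.sum : ℕ) : ℝ) ≤ ν * n →
        ∑ σ, w₁ σ * patternCount S σ = ∑ σ, w₂ σ * patternCount S σ) ∧
    (∑ σ, w₁ σ * y ^ (σ.cycleType.card + (n - σ.cycleType.sum)) ≠
      ∑ σ, w₂ σ * y ^ (σ.cycleType.card + (n - σ.cycleType.sum)))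

/-- Pattern counts vanish on the identity and on the long cycle for every non-empty pattern of total `< n + 2`,
and equal `1` on the empty pattern: so they agree. [folklore] -/
theorem patternCount_one_eq_finRotate (n : ℕ) (S : Multiset ℕ) (hS : S.sum < n + 2) :
    patternCount S (1 : Equiv.Perm (Fin (n + 2))) = patternCount S (finRotate (n + 2)) := by
  unfold patternCount
  refine Finset.prod_congr rfl fun j hj => ?_
  rw [Multiset.mem_toFinset] at hj
  have hjle : j ≤ S.sum := Multiset.le_sum_of_mem hj
  have hjne : j ≠ n + 2 := by omega
  rw [Equiv.Perm.cycleType_one, cycleType_finRotate, Multiset.count_zero, Multiset.count_singleton,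
    if_neg hjne]

/-- JUNK INHABITANT of the typed first lemma: `SignFreeSlack (n+2) ν y` for all `ν < 1 < y`, witnessed by the
point masses at `1` and at `finRotate (n+2)`. [folklore] -/
theorem signFreeSlack_junk (n : ℕ) {ν y : ℝ} (hν : ν < 1) (hy : 1 < y) : SignFreeSlack (n + 2) ν y := by
  classical
  refine ⟨fun σ => if σ = 1 then 1 else 0, fun σ => if σ = finRotate (n + 2) then 1 else 0,
    fun σ => by positivity, fun σ => by positivity, by simp, by simp, fun S hS => ?_, ?_⟩
  · -- pattern constraints: both sides reduce to the pattern count at one permutation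
    have hsum : S.sum < n + 2 := by
      have h1 : ν * ((n + 2 : ℕ) : ℝ) < 1 * ((n + 2 : ℕ) : ℝ) :=
        mul_lt_mul_of_pos_right hν (by positivity)
      have h2 : ((S.sum : ℕ) : ℝ) < ((n + 2 : ℕ) : ℝ) := by linarith
      exact_mod_cast h2
    simp only [ite_mul, one_mul, zero_mul, Finset.sum_ite_eq', Finset.mem_univ, if_true]
    exact_mod_cast congrArg (Nat.cast (R := ℝ)) (patternCount_one_eq_finRotate n S hsum)
  · -- objectives differ: y^(n+2) ≠ y^1
    simp only [ite_mul, one_mul, zero_mul, Finset.sum_ite_eq', Finset.mem_univ, if_true,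
      Equiv.Perm.cycleType_one, cycleType_finRotate, Multiset.card_zero, Multiset.sum_zero,
      Multiset.card_singleton, Multiset.sum_singleton, zero_add, Nat.sub_zero, Nat.sub_self, add_zero, pow_one]
    have : y ^ 1 < y ^ (n + 2) := pow_lt_pow_right₀ hy (by omega)
    rw [pow_one] at this
    exact this.ne'

/-- In particular at the Dirichlet–Hooley parameters `ν = 1/2`, `y = 2`, where the intended statement is false,
the typed one holds. [folklore] -/
theorem signFreeSlack_half_two (n : ℕ) : SignFreeSlack (n + 2) (1 / 2) 2 :=
  signFreeSlack_junk n (by norm_num) (by norm_num)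

end Summit.Parity.BatemanHorn.Cruxes.SystemLSDRealSegment.Triage
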